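import Summits.Ventures.Crystal3D.Theorems.StickyWulffConstantGenericWallFloorCoreResidualTilt
import Summits.Ventures.Crystal3D.Theorems.StickyWulffConstantGenericWallFloorSigma9Wide
import Summits.Ventures.Crystal3D.Theorems.StickyWulffConstantGenericWallFloorInPlaneTwinStarPairHolds
import HarnessLib

/-!
# The ray-aligned core of `GenericWallFloor` MINUS six priced one-sided `Σ9` classes (the two of record, their tilted and their
# WIDE-tilted extensions): the crux by name from `ExactOnly`(C12-55), `StarPairFar` and the wide residual
# (crux `GenericWallFloor`, stmt-Ventures-19480, line `WallLedgerG`)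

HONEST FRAMING. Venture `Summits/Ventures/Crystal3D` (cell `crystal3d-full`), helper `--supports` the crux `GenericWallFloor`,
REGISTERED line `WallLedgerG`, open stub `stub_twoSlabAdhesion`.  BOOKKEEPING CAPSTONE, rung credit only; F-C1 not moved; NOT
the crux.  `…CoreResidualTilt` (19480-p1 g7) one step further: `Sigma9WideAt` / `Sigma9WideDownAt` (hypothesis lists of
`genericWallFloorAtCharge_sigma9{,Down}_wide_of_far` + flux `κ₁+κ₂ ≥ 2`), `GenericWallFloorCoreResidualWide`,
**`genericWallFloor_of_coreResidualWide : ExactOnly C12-55 → StarPairFar → ResidualWide → GenericWallFloor`** and the converse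
inclusion.  Census (`calc/tilt_coverage_wide.py`, 900 Haar `Σ9` pairs): the six classes cover `≈ 97.7 %` of `Σ9` orientations
(`1/4`-tilt: `94.5 %`; record: `83 %`).  WHAT THIS IS NOT: a proof of the residual; F-C1 not moved.
-/

noncomputable section

namespace Summit.Ventures.Crystal3D.Theorems

open Summit.Ventures.Crystal3D Finset
open Literature.MathematicalPhysics.StatisticalMechanics (fccStacking barlowStacking IsHaggSeq)
open scoped InnerProductSpace

/-- **The lower one-sided `Σ9` class with WIDE tilted verticals** (`Sigma9WideAt A₁ A₂`, tilt `≤ 1/3`): the hypothesis list of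
`genericWallFloorAtCharge_sigma9_tilt_of_far` — unit verticals `z₁`, `z₂` within `1/4` of `e₃`, `−e₃`; a reduced
two-letter model menu word with `A₂·Λ₀ = (wordFrame A₁ [μk, μk1])·Λ₀`; a slot `u₁` of grain 1 steep for `z₁` IN the
first mirror plane; a slot `u₂` of grain 2 steep for `z₂` with the level-two condition read for `z₂`; and enough flux,
`√2|⟪A₁u₁,e₃⟫| + √2|⟪A₂u₂,e₃⟫| ≥ 2`, for the charge to reach the crux's `1`. -/
def Sigma9WideAt (A₁ A₂ : EuclideanSpace ℝ (Fin 3) ≃ₗᵢ[ℝ] EuclideanSpace ℝ (Fin 3)) : Prop :=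
  ∃ (z₁ z₂ u₁ u₂ μk μk1 : EuclideanSpace ℝ (Fin 3)), ‖z₁‖ = 1 ∧ ‖z₁ - EuclideanSpace.single (2 : Fin 3) (1 : ℝ)‖ ≤ 1 / 3 ∧
    ‖z₂‖ = 1 ∧ ‖z₂ + EuclideanSpace.single (2 : Fin 3) (1 : ℝ)‖ ≤ 1 / 3 ∧
    u₁ ∈ fccSlots ∧ Real.sqrt 2 / 2 ≤ ⟪A₁ u₁, z₁⟫_ℝ ∧ u₂ ∈ fccSlots ∧ Real.sqrt 2 / 2 ≤ ⟪A₂ u₂, z₂⟫_ℝ ∧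
    2 ≤ Real.sqrt 2 * |⟪A₁ u₁, EuclideanSpace.single (2 : Fin 3) (1 : ℝ)⟫_ℝ| + Real.sqrt 2 * |⟪A₂ u₂, EuclideanSpace.single (2 : Fin 3) (1 : ℝ)⟫_ℝ| ∧
    (∀ μ ∈ [μk, μk1], ‖μ‖ = 1 ∧
      ∀ w ∈ fccSlots, ⟪w, μ⟫_ℝ = 0 ∨ ⟪w, μ⟫_ℝ = Real.sqrt (2 / 3) ∨ ⟪w, μ⟫_ℝ = -Real.sqrt (2 / 3)) ∧
    List.IsChain (fun μ μ' => ⟪μ, μ'⟫_ℝ = 1 / 3 ∨ ⟪μ, μ'⟫_ℝ = -1 / 3) [μk, μk1] ∧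
    A₂ '' fccStacking 1 (Real.sqrt (2 / 3)) = (wordFrame A₁ [μk, μk1]) '' fccStacking 1 (Real.sqrt (2 / 3)) ∧
    ⟪u₁, μk1⟫_ℝ = 0 ∧
    (∀ n₁ : EuclideanSpace ℝ (Fin 3),
      (n₁ = wordFrame A₁ [μk, μk1] μk ∨ n₁ = -wordFrame A₁ [μk, μk1] μk) → ⟪A₂ u₂, n₁⟫_ℝ = Real.sqrt (2 / 3) →
      ∀ q ∈ fccSlots, 0 < ⟪twinFrame A₂ n₁ q, n₁⟫_ℝ →
        (∀ q' ∈ fccSlots, 0 < ⟪twinFrame A₂ n₁ q', n₁⟫_ℝ → ⟪twinFrame A₂ n₁ q', z₂⟫_ℝ ≤ ⟪twinFrame A₂ n₁ q, z₂⟫_ℝ) →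
        (wordFrame A₁ [μk, μk1]).symm (A₂ ((twinFrame A₂ n₁).symm ((2 * Real.sqrt (2 / 3)) • twinFrame A₂ n₁ q - n₁))) ≠ μk1 ∧
        (wordFrame A₁ [μk, μk1]).symm (A₂ ((twinFrame A₂ n₁).symm ((2 * Real.sqrt (2 / 3)) • twinFrame A₂ n₁ q - n₁))) ≠ -μk1) ∧
    (∀ n₁ : EuclideanSpace ℝ (Fin 3),
      (n₁ = wordFrame A₁ [μk, μk1] μk ∨ n₁ = -wordFrame A₁ [μk, μk1] μk) → ⟪A₂ u₂, n₁⟫_ℝ = Real.sqrt (2 / 3) →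
      ∀ q ∈ fccSlots, 0 < ⟪twinFrame A₂ n₁ q, n₁⟫_ℝ →
        (∀ q' ∈ fccSlots, 0 < ⟪twinFrame A₂ n₁ q', n₁⟫_ℝ → ⟪twinFrame A₂ n₁ q', z₂⟫_ℝ ≤ ⟪twinFrame A₂ n₁ q, z₂⟫_ℝ) →
        ⟪twinFrame A₂ n₁ q, A₁ μk1⟫_ℝ = 0)

/-- **The upper one-sided `Σ9` class with WIDE tilted verticals** (`Sigma9WideDownAt A₁ A₂`, mirror image: grain 2
carries the word `A₁·Λ₀ = (wordFrame A₂ [μk, μk1])·Λ₀` and the in-plane slot, grain 1 the level-two condition read for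
`z₁`). -/
def Sigma9WideDownAt (A₁ A₂ : EuclideanSpace ℝ (Fin 3) ≃ₗᵢ[ℝ] EuclideanSpace ℝ (Fin 3)) : Prop :=
  ∃ (z₁ z₂ u₁ u₂ μk μk1 : EuclideanSpace ℝ (Fin 3)), ‖z₁‖ = 1 ∧ ‖z₁ - EuclideanSpace.single (2 : Fin 3) (1 : ℝ)‖ ≤ 1 / 3 ∧
    ‖z₂‖ = 1 ∧ ‖z₂ + EuclideanSpace.single (2 : Fin 3) (1 : ℝ)‖ ≤ 1 / 3 ∧
    u₁ ∈ fccSlots ∧ Real.sqrt 2 / 2 ≤ ⟪A₁ u₁, z₁⟫_ℝ ∧ u₂ ∈ fccSlots ∧ Real.sqrt 2 / 2 ≤ ⟪A₂ u₂, z₂⟫_ℝ ∧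
    2 ≤ Real.sqrt 2 * |⟪A₁ u₁, EuclideanSpace.single (2 : Fin 3) (1 : ℝ)⟫_ℝ| + Real.sqrt 2 * |⟪A₂ u₂, EuclideanSpace.single (2 : Fin 3) (1 : ℝ)⟫_ℝ| ∧
    (∀ μ ∈ [μk, μk1], ‖μ‖ = 1 ∧
      ∀ w ∈ fccSlots, ⟪w, μ⟫_ℝ = 0 ∨ ⟪w, μ⟫_ℝ = Real.sqrt (2 / 3) ∨ ⟪w, μ⟫_ℝ = -Real.sqrt (2 / 3)) ∧
    List.IsChain (fun μ μ' => ⟪μ, μ'⟫_ℝ = 1 / 3 ∨ ⟪μ, μ'⟫_ℝ = -1 / 3) [μk, μk1] ∧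
    A₁ '' fccStacking 1 (Real.sqrt (2 / 3)) = (wordFrame A₂ [μk, μk1]) '' fccStacking 1 (Real.sqrt (2 / 3)) ∧
    ⟪u₂, μk1⟫_ℝ = 0 ∧
    (∀ n₁ : EuclideanSpace ℝ (Fin 3),
      (n₁ = wordFrame A₂ [μk, μk1] μk ∨ n₁ = -wordFrame A₂ [μk, μk1] μk) → ⟪A₁ u₁, n₁⟫_ℝ = Real.sqrt (2 / 3) →
      ∀ q ∈ fccSlots, 0 < ⟪twinFrame A₁ n₁ q, n₁⟫_ℝ →
        (∀ q' ∈ fccSlots, 0 < ⟪twinFrame A₁ n₁ q', n₁⟫_ℝ → ⟪twinFrame A₁ n₁ q', z₁⟫_ℝ ≤ ⟪twinFrame A₁ n₁ q, z₁⟫_ℝ) →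
        (wordFrame A₂ [μk, μk1]).symm (A₁ ((twinFrame A₁ n₁).symm ((2 * Real.sqrt (2 / 3)) • twinFrame A₁ n₁ q - n₁))) ≠ μk1 ∧
        (wordFrame A₂ [μk, μk1]).symm (A₁ ((twinFrame A₁ n₁).symm ((2 * Real.sqrt (2 / 3)) • twinFrame A₁ n₁ q - n₁))) ≠ -μk1) ∧
    (∀ n₁ : EuclideanSpace ℝ (Fin 3),
      (n₁ = wordFrame A₂ [μk, μk1] μk ∨ n₁ = -wordFrame A₂ [μk, μk1] μk) → ⟪A₁ u₁, n₁⟫_ℝ = Real.sqrt (2 / 3) →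
      ∀ q ∈ fccSlots, 0 < ⟪twinFrame A₁ n₁ q, n₁⟫_ℝ →
        (∀ q' ∈ fccSlots, 0 < ⟪twinFrame A₁ n₁ q', n₁⟫_ℝ → ⟪twinFrame A₁ n₁ q', z₁⟫_ℝ ≤ ⟪twinFrame A₁ n₁ q, z₁⟫_ℝ) →
        ⟪twinFrame A₁ n₁ q, A₂ μk1⟫_ℝ = 0)

/-- **The WIDE residual of lane G**: the crux's matrix, verbatim, on every non-co-axial RAY-ALIGNED pair that lies in NONE of
the six priced one-sided `Σ9` classes (record, tilted, wide-tilted). -/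
def GenericWallFloorCoreResidualWide : Prop :=
  ∀ (A₁ : EuclideanSpace ℝ (Fin 3) ≃ₗᵢ[ℝ] EuclideanSpace ℝ (Fin 3)) (t₁ : EuclideanSpace ℝ (Fin 3))
    (A₂ : EuclideanSpace ℝ (Fin 3) ≃ₗᵢ[ℝ] EuclideanSpace ℝ (Fin 3)) (t₂ : EuclideanSpace ℝ (Fin 3)),
    ¬ (∃ (L : EuclideanSpace ℝ (Fin 3) ≃ₗᵢ[ℝ] EuclideanSpace ℝ (Fin 3)) (s₁ s₂ : EuclideanSpace ℝ (Fin 3))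
        (σ σ' : ℤ → ℤ), IsHaggSeq σ ∧ IsHaggSeq σ' ∧
        (fun p => A₁ p + t₁) '' fccStacking 1 (Real.sqrt (2 / 3)) ⊆
          (fun p => L p + s₁) '' barlowStacking 1 (Real.sqrt (2 / 3)) σ ∧
        (fun p => A₂ p + t₂) '' fccStacking 1 (Real.sqrt (2 / 3)) ⊆
          (fun p => L p + s₂) '' barlowStacking 1 (Real.sqrt (2 / 3)) σ') →
    RayAlignedAt A₁ A₂ → ¬ Sigma9OneSidedAt A₁ A₂ → ¬ Sigma9OneSidedDownAt A₁ A₂ →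
    ¬ Sigma9TiltAt A₁ A₂ → ¬ Sigma9TiltDownAt A₁ A₂ → ¬ Sigma9WideAt A₁ A₂ → ¬ Sigma9WideDownAt A₁ A₂ →
    GenericWallFloorAt A₁ t₁ A₂ t₂

/-- Pairs in the lower wide-tilted `Σ9` class satisfy the crux's matrix (modulo `ExactOnly`(C12-55), `StarPairFar`). -/
theorem genericWallFloorAt_of_sigma9WideAt
    {s₀ : EuclideanSpace ℝ (Fin 3)} (hs₀ : s₀ ∈ fccSlots)
    (hcert : ExactOnly 0 (fccSlots.filter fun w => 0 < ⟪w, s₀⟫_ℝ)) (hfar : StarPairFar)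
    {A₁ A₂ : EuclideanSpace ℝ (Fin 3) ≃ₗᵢ[ℝ] EuclideanSpace ℝ (Fin 3)} (h : Sigma9WideAt A₁ A₂)
    (t₁ t₂ : EuclideanSpace ℝ (Fin 3)) : GenericWallFloorAt A₁ t₁ A₂ t₂ := by
  obtain ⟨z₁, z₂, u₁, u₂, μk, μk1, hz₁, hze₁, hz₂, hze₂, hu₁, hsteep₁, hu₂, hsteep₂, hflux, hκl, hκc, hA₂, hfirst,
    hsecond, hcap⟩ := h
  exact genericWallFloorAt_of_charge_one (genericWallFloorAtCharge_mono (by linarith only [hflux])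
    (genericWallFloorAtCharge_sigma9_wide_of_far hs₀ hcert hfar inPlaneTwinStarPair_holds A₁ t₁ A₂ t₂ hz₁ hze₁ hz₂ hze₂
      hu₁ hsteep₁ hu₂ hsteep₂ μk μk1 hκl hκc hA₂ hfirst hsecond hcap))

/-- Pairs in the upper wide-tilted `Σ9` class satisfy the crux's matrix (modulo `ExactOnly`(C12-55), `StarPairFar`). -/
theorem genericWallFloorAt_of_sigma9WideDownAt
    {s₀ : EuclideanSpace ℝ (Fin 3)} (hs₀ : s₀ ∈ fccSlots)
    (hcert : ExactOnly 0 (fccSlots.filter fun w => 0 < ⟪w, s₀⟫_ℝ)) (hfar : StarPairFar)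
    {A₁ A₂ : EuclideanSpace ℝ (Fin 3) ≃ₗᵢ[ℝ] EuclideanSpace ℝ (Fin 3)} (h : Sigma9WideDownAt A₁ A₂)
    (t₁ t₂ : EuclideanSpace ℝ (Fin 3)) : GenericWallFloorAt A₁ t₁ A₂ t₂ := by
  obtain ⟨z₁, z₂, u₁, u₂, μk, μk1, hz₁, hze₁, hz₂, hze₂, hu₁, hsteep₁, hu₂, hsteep₂, hflux, hκl, hκc, hA₁, hfirst,
    hsecond, hcap⟩ := h
  exact genericWallFloorAt_of_charge_one (genericWallFloorAtCharge_mono (by linarith only [hflux])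
    (genericWallFloorAtCharge_sigma9Down_wide_of_far hs₀ hcert hfar inPlaneTwinStarPair_holds A₁ t₁ A₂ t₂ hz₁ hze₁ hz₂
      hze₂ hu₁ hsteep₁ hu₂ hsteep₂ μk μk1 hκl hκc hA₁ hfirst hsecond hcap))

/-- **The crux BY NAME from `ExactOnly`(C12-55), `StarPairFar` and the WIDE residual.** -/
theorem genericWallFloor_of_coreResidualWide
    {s₀ : EuclideanSpace ℝ (Fin 3)} (hs₀ : s₀ ∈ fccSlots)
    (hcert : ExactOnly 0 (fccSlots.filter fun w => 0 < ⟪w, s₀⟫_ℝ)) (hfar : StarPairFar)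
    (hres : GenericWallFloorCoreResidualWide) :
    Summit.Ventures.Crystal3D.Theses.StickyWulffConstant.GenericWallFloor := by
  refine genericWallFloor_of_coreResidualTilt hs₀ hcert hfar fun A₁ t₁ A₂ t₂ hnc hra h₁ h₂ h₃ h₄ => ?_
  by_cases h₅ : Sigma9WideAt A₁ A₂
  · exact genericWallFloorAt_of_sigma9WideAt hs₀ hcert hfar h₅ t₁ t₂
  by_cases h₆ : Sigma9WideDownAt A₁ A₂
  · exact genericWallFloorAt_of_sigma9WideDownAt hs₀ hcert hfar h₆ t₁ t₂
  exact hres A₁ t₁ A₂ t₂ hnc hra h₁ h₂ h₃ h₄ h₅ h₆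

/-- The wide residual is implied by the previous one (and hence by the crux): nothing is smuggled. -/
theorem genericWallFloorCoreResidualWide_of_coreResidualTilt (h : GenericWallFloorCoreResidualTilt) :
    GenericWallFloorCoreResidualWide :=
  fun A₁ t₁ A₂ t₂ hnc hra h₁ h₂ h₃ h₄ _ _ => h A₁ t₁ A₂ t₂ hnc hra h₁ h₂ h₃ h₄

/-- The crux implies the wide residual. -/
theorem genericWallFloorCoreResidualWide_of_genericWallFloor
    (h : Summit.Ventures.Crystal3D.Theses.StickyWulffConstant.GenericWallFloor) : GenericWallFloorCoreResidualWide :=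
  genericWallFloorCoreResidualWide_of_coreResidualTilt (genericWallFloorCoreResidualTilt_of_genericWallFloor h)

end Summit.Ventures.Crystal3D.Theorems

end
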